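import Summits.AtomisticToContinuum.Crystallization.Theorems.ExcessDecayLiouvillePhononStabilityCertChartId
import Summits.AtomisticToContinuum.Crystallization.Theorems.ExcessDecayLiouvillePhononStabilityCertRange
import Summits.AtomisticToContinuum.Crystallization.Theorems.ExcessDecayLiouvillePhononStabilityCertRangeSum
import Summits.AtomisticToContinuum.Crystallization.Theorems.ExcessDecayLiouvillePhononStabilityFarControl
import Summits.AtomisticToContinuum.Crystallization.Theorems.ExcessDecayLiouvillePhononStabilityPathBound
import Summits.AtomisticToContinuum.Crystallization.Theorems.ExcessDecayLiouvillePhononStabilityChainBound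

/-!
# Near-certificate layer X: the far-field charges of the target as polynomial pair forms

Support file for crux `PhononStability` (stmt-AtomisticToContinuum-9333), line `contragredient-window-collapse`
(lead c2).  The three far-field pieces of `NearCertificate` are turned into computable target pieces:

* the CHAIN CHARGES on `(Rn, Rf]`: `chargePPF C qn qf` (for every class of the computable range
  `classRange qn qf`, the rational far bound `U(Q(c)) ≥ |ω|` times the chain length times the directional pair
  forms `pair(s, ζ̂_c ζ̂_cᵀ)` of the steps of its nearest-neighbour chain `chainNN c`, polynomial in the shift
  variables) with `evalPPF (chargePPF …) ≤ −chargeSum Rn Rf chainNN A δ w` (`charge_le`);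
* the MID-RANGE assignment `midP D` (`pathConst` rounded up so that `farCoeff c · midP D c` is an integer over `D`),
  its `MidBound`, and the identity `Σ_{(Rf,R∞]} farCoeff · midP D = (sumRange (midCeil D) qf q∞)/D` with a
  non-materialising range sum (`…CertRangeSum`-style loops are in `sumRange`);
* the `N0`-charge `farN0PPF K` with `evalPPF (farN0PPF K) = −K · N0 w`.

Also: the far range `farClasses Rn Rf` IS `(classRange qn qf).toFinset` for `qn = 36Rn²`, `qf = 36Rf²`. [folklore]
-/

noncomputable section

open scoped BigOperators Classical InnerProductSpace
open Filter Set Function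
open Summit.AtomisticToContinuum.Crystallization.Theorems.PhononStabilityNegative
open Summit.AtomisticToContinuum.Crystallization.Theorems.PhononStabilityCWC.FarControlStub

namespace Summit.AtomisticToContinuum.Crystallization.Theorems.PhononStabilityCWC.Cert

local notation "E3" => EuclideanSpace ℝ (Fin 3)

/-! ## The far range as a computable list -/

/-- **the far range is the computable exact range:** `farClasses Rn Rf = {qn < Q ≤ qf}`. [folklore] -/
theorem farClasses_eq_toFinset {Rn Rf : ℝ} {bn bf : ℕ} {qn qf : ℤ} (hbn : ⌈2 * Rn⌉₊ + 1 = bn)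
    (hqn : ((qn : ℤ) : ℝ) = 36 * Rn ^ 2) (hbf : ⌈2 * Rf⌉₊ + 1 = bf) (hqf : ((qf : ℤ) : ℝ) = 36 * Rf ^ 2)
    (hRn : 0 ≤ Rn) (hRf : 0 ≤ Rf) : farClasses Rn Rf = (classRange qn qf).toFinset := by
  ext c
  rw [mem_farClasses, List.mem_toFinset, mem_classesR_iff hbf hqf hRf, mem_classesR_iff hbn hqn hRn]
  constructor
  · rintro ⟨⟨-, h1⟩, h2⟩
    refine mem_classRange_of_qint ?_ h1
    by_contra h
    push Not at h
    exact h2 ⟨mem_boxFin_of_qint_le hbn hqn hRn h, h⟩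
  · intro h
    obtain ⟨h1, h2⟩ := qint_of_mem_classRange h
    exact ⟨⟨mem_boxFin_of_qint_le hbf hqf hRf h2, h2⟩, fun h3 => by omega⟩

/-- a `Finset.sum` over the far range as a list sum over the computable range. [folklore] -/
theorem sum_farClasses_eq {Rn Rf : ℝ} {bn bf : ℕ} {qn qf : ℤ} (hbn : ⌈2 * Rn⌉₊ + 1 = bn)
    (hqn : ((qn : ℤ) : ℝ) = 36 * Rn ^ 2) (hbf : ⌈2 * Rf⌉₊ + 1 = bf) (hqf : ((qf : ℤ) : ℝ) = 36 * Rf ^ 2)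
    (hRn : 0 ≤ Rn) (hRf : 0 ≤ Rf) (g : BondClass → ℝ) :
    ∑ c ∈ farClasses Rn Rf, g c = ((classRange qn qf).map g).sum := by
  rw [farClasses_eq_toFinset hbn hqn hbf hqf hRn hRf, List.sum_toFinset _ (nodup_classRange qn qf)]

/-- `Σ (−f) = −Σ f` for list sums. [folklore] -/
theorem list_sum_map_neg {α : Type*} (l : List α) (f : α → ℝ) : (l.map fun a => -f a).sum = -(l.map f).sum := by
  induction l with
  | nil => simp
  | cons a rest ih => simp [ih]; ring

/-! ## The chain charges -/

/-- all steps of all nearest-neighbour chains of the range are nearest-neighbour classes (checked) -/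
def chainsNN (qn qf : ℤ) : Bool := (classRange qn qf).all fun c => (chainNN c).all fun s => decide (s ∈ nnList)

/-- a nearest-neighbour class has unit reference length. [folklore] -/
theorem norm_bondVec_zero_of_mem_nnList {s : BondClass} (hs : s ∈ nnList) : ‖bondVec 0 s‖ = 1 := by
  have hq : Qint s = 36 := by
    revert s; decide
  have h := qint_cast s
  rw [hq] at h
  have h1 : ‖bondVec 0 s‖ ^ 2 = 1 := by push_cast at h; linarith
  have h0 : 0 ≤ ‖bondVec 0 s‖ := norm_nonneg _
  nlinarith

/-- the chain constant of a nearest-neighbour chain is its length. [folklore] -/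
theorem chainConst_eq_length {ch : List BondClass} (h : ∀ s ∈ ch, s ∈ nnList) : chainConst ch = ch.length := by
  unfold chainConst
  induction ch with
  | nil => simp
  | cons s rest ih =>
      rw [List.map_cons, List.sum_cons, norm_bondVec_zero_of_mem_nnList (h s (List.mem_cons_self ..)),
        ih (fun t ht => h t (List.mem_cons_of_mem _ ht)), List.length_cons]
      push_cast; ring

/-- the directional sum of a chain as pair forms of `ζ̂_c ζ̂_cᵀ`. [folklore] -/
theorem chain_dir_sum_eq (C : CellData) (A B : E3 →L[ℝ] E3) (δ : E3) (c : BondClass) (w : Label → E3)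
    {ch : List BondClass} (h : ∀ s ∈ ch, s ∈ nnList) :
    (ch.map fun s => ‖bondVec 0 s‖⁻¹ * dirForm (bondVec δ c) s w).sum =
      (ch.map fun s => pairEvalR s (matVal (chartX C A B δ) (LmatP C c)) w).sum := by
  congr 1
  refine List.map_congr_left fun s hs => ?_
  rw [norm_bondVec_zero_of_mem_nnList (h s hs), inv_one, one_mul, dirForm, dirForm_eq_pairEvalR, matVal_LmatP,
    contraOf_bondVec]

/-- the chain charge of a class over the range, as a polynomial pair form (shift variables only) -/
def chargeTermPPF (C : CellData) (c : BondClass) : PolyPF :=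
  mulSP [([], -(uOfQ (Qint c) * (chainNN c).length))] ((chainNN c).flatMap fun s => classPPF s (LmatP C c))

/-- **`chargePPF`:** minus the chain charges of the range `(qn, qf]`. -/
def chargePPF (C : CellData) (qn qf : ℤ) : PolyPF := (classRange qn qf).flatMap fun c => chargeTermPPF C c

/-- evaluation of one charge term. [folklore] -/
theorem evalPPF_chargeTermPPF (C : CellData) (A B : E3 →L[ℝ] E3) (δ : E3) (c : BondClass) {w : Label → E3}
    (hw : (support w).Finite) :
    evalPPF (chargeTermPPF C c) (chartX C A B δ) w = -(uOfQ (Qint c) * (chainNN c).length) *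
      ((chainNN c).map fun s => pairEvalR s (matVal (chartX C A B δ) (LmatP C c)) w).sum := by
  unfold chargeTermPPF
  rw [evalPPF_mulSP, evalPPF_flatMap]
  have h1 : spEval [([], -(uOfQ (Qint c) * ((chainNN c).length : ℚ)))] (chartX C A B δ) =
      -(uOfQ (Qint c) * (chainNN c).length) := by simp [spEval, monoVal]
  rw [h1]
  congr 1
  congr 1
  exact List.map_congr_left fun s _ => evalPPF_classPPF hw s (LmatP C c) _

/-- **validity of the chain charges:** `evalPPF (chargePPF …) ≤ −chargeSum Rn Rf chainNN A δ w`. -/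
theorem charge_le (hC : ChainBound) {Rn Rf : ℝ} {bn bf : ℕ} {qn qf : ℤ} (hbn : ⌈2 * Rn⌉₊ + 1 = bn)
    (hqn : ((qn : ℤ) : ℝ) = 36 * Rn ^ 2) (hbf : ⌈2 * Rf⌉₊ + 1 = bf) (hqf : ((qf : ℤ) : ℝ) = 36 * Rf ^ 2)
    (hRn : 2 ≤ Rn) (hRf : 0 ≤ Rf) (hvalid : ValidChains Rn Rf chainNN) (hnn : chainsNN qn qf = true)
    (C : CellData) {A B : E3 →L[ℝ] E3} {δ : E3} (hW : CellWindow A) (hδ : ShiftWindow A δ)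
    {w : Label → E3} (hw : (support w).Finite) :
    evalPPF (chargePPF C qn qf) (chartX C A B δ) w ≤ -chargeSum Rn Rf chainNN A δ w := by
  have hRn0 : 0 ≤ Rn := by linarith
  unfold chargeSum
  rw [sum_farClasses_eq hbn hqn hbf hqf hRn0 hRf, chargePPF, evalPPF_flatMap, ← list_sum_map_neg]
  refine List.sum_le_sum fun c hc => ?_
  have hcF : c ∈ farClasses Rn Rf := by
    rw [farClasses_eq_toFinset hbn hqn hbf hqf hRn0 hRf, List.mem_toFinset]; exact hc
  have hnnc : ∀ s ∈ chainNN c, s ∈ nnList := by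
    unfold chainsNN at hnn
    rw [List.all_eq_true] at hnn
    have := hnn c hc
    rw [List.all_eq_true] at this
    intro s hs; simpa using this s hs
  have hQ : 144 ≤ Qint c := by
    obtain ⟨h1, -⟩ := qint_of_mem_classRange hc
    have : (144 : ℝ) ≤ (qn : ℝ) := by rw [hqn]; nlinarith
    have h144 : (144 : ℤ) ≤ qn := by exact_mod_cast this
    omega
  have hU := abs_omegaLJ_le_uOfQ hW hδ hQ
  -- chainCharge = L · Σ_s pair(s, ζ̂ζ̂ᵀ)
  have hcc : chainCharge δ c (chainNN c) w =
      (chainNN c).length * ((chainNN c).map fun s => pairEvalR s (matVal (chartX C A B δ) (LmatP C c)) w).sum := by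
    unfold chainCharge
    rw [chainConst_eq_length hnnc, chain_dir_sum_eq C A B δ c w hnnc]
  have hX0 : 0 ≤ chainCharge δ c (chainNN c) w :=
    le_trans (tsum_nonneg fun _ => by positivity) (longForm_le_chainCharge hC hvalid δ hw hcF)
  rw [evalPPF_chargeTermPPF C A B δ c hw]
  rw [hcc] at hX0 ⊢
  set S := ((chainNN c).map fun s => pairEvalR s (matVal (chartX C A B δ) (LmatP C c)) w).sum
  set L : ℝ := ((chainNN c).length : ℝ)
  have hLS : 0 ≤ L * S := hX0
  have : |omegaLJ ‖A (bondVec δ c)‖| * (L * S) ≤ (uOfQ (Qint c) : ℝ) * (L * S) :=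
    mul_le_mul_of_nonneg_right hU hLS
  nlinarith

/-! ## The mid-range assignment and its constant -/

/-- integer path constant (`pathConst c = pathConstZ c`) -/
def pathConstZ (c : BondClass) : ℤ :=
  (2 * |c.2.2 2| + |c.2.2 0| + |c.2.2 1| + 1) * (max (max |c.2.2 0| |c.2.2 1|) |c.2.2 2| + 1)

/-- `pathConst` is the cast of `pathConstZ`. [folklore] -/
theorem pathConst_eq_cast (c : BondClass) : pathConst c = (pathConstZ c : ℝ) := by
  unfold pathConst pathConstZ; push_cast; ring

/-- the rational far coefficient `18·(36/Q)⁴` (`= farCoeff c` for `Q(c) ≠ 0`) -/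
def farCoeffQ (c : BondClass) : ℚ := 18 * (36 / (Qint c : ℚ)) ^ 4

/-- `farCoeff c = farCoeffQ c` for classes with `Q(c) ≠ 0`. [folklore] -/
theorem farCoeff_eq_cast {c : BondClass} (hQ : Qint c ≠ 0) : farCoeff c = (farCoeffQ c : ℝ) := by
  have h := qint_cast c
  have hQr : ((Qint c : ℤ) : ℝ) ≠ 0 := by exact_mod_cast hQ
  have hn : ‖bondVec 0 c‖ ^ 2 = (Qint c : ℝ) / 36 := by rw [h]; ring
  unfold farCoeff farCoeffQ
  push_cast
  have hpow : (‖bondVec 0 c‖⁻¹) ^ 8 = ((‖bondVec 0 c‖ ^ 2)⁻¹) ^ 4 := by rw [← inv_pow, ← pow_mul]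
  rw [hpow, hn, inv_div]

/-- the rounded-up integer numerator `⌈farCoeffQ · pathConst · D⌉` -/
def midCeil (D : ℕ) (c : BondClass) : ℤ := ⌈farCoeffQ c * pathConstZ c * D⌉

/-- the mid-range assignment `P c = ⌈farCoeffQ·pathConst·D⌉ / (D · farCoeffQ)` (so that `farCoeff·P` is an
integer over `D` and `P ≥ pathConst`) -/
def midP (D : ℕ) (c : BondClass) : ℝ := (midCeil D c : ℝ) / ((D : ℝ) * farCoeffQ c)

/-- `farCoeffQ > 0` for `Q > 0`. [folklore] -/
theorem farCoeffQ_pos {c : BondClass} (hQ : 0 < Qint c) : 0 < farCoeffQ c := by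
  unfold farCoeffQ
  have : (0 : ℚ) < Qint c := by exact_mod_cast hQ
  positivity

/-- `pathConst ≥ 0`. [folklore] -/
theorem pathConstZ_nonneg (c : BondClass) : 0 ≤ pathConstZ c := by
  unfold pathConstZ
  have h0 := abs_nonneg (c.2.2 0); have h1 := abs_nonneg (c.2.2 1); have h2 := abs_nonneg (c.2.2 2)
  have hm : 0 ≤ max (max |c.2.2 0| |c.2.2 1|) |c.2.2 2| := le_trans h2 (le_max_right _ _)
  positivity

/-- **`pathConst ≤ midP D`** (rounding up). [folklore] -/
theorem pathConst_le_midP {D : ℕ} (hD : 0 < D) {c : BondClass} (hQ : 0 < Qint c) : pathConst c ≤ midP D c := by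
  have hf := farCoeffQ_pos hQ
  have hfr : (0 : ℝ) < farCoeffQ c := by exact_mod_cast hf
  have hDr : (0 : ℝ) < D := by exact_mod_cast hD
  unfold midP midCeil
  rw [pathConst_eq_cast, le_div_iff₀ (by positivity)]
  have hc := Int.le_ceil (farCoeffQ c * pathConstZ c * D)
  have hc' : ((farCoeffQ c * pathConstZ c * D : ℚ) : ℝ) ≤ ((⌈farCoeffQ c * pathConstZ c * D⌉ : ℤ) : ℝ) := by
    exact_mod_cast hc
  push_cast at hc' ⊢
  nlinarith

/-- `0 ≤ midP D c`. [folklore] -/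
theorem midP_nonneg {D : ℕ} (hD : 0 < D) {c : BondClass} (hQ : 0 < Qint c) : 0 ≤ midP D c :=
  le_trans (by rw [pathConst_eq_cast]; exact_mod_cast pathConstZ_nonneg c) (pathConst_le_midP hD hQ)

/-- **`farCoeff c · midP D c = midCeil D c / D`.** [folklore] -/
theorem farCoeff_mul_midP {D : ℕ} (hD : 0 < D) {c : BondClass} (hQ : 0 < Qint c) :
    farCoeff c * midP D c = (midCeil D c : ℝ) / D := by
  have hf := farCoeffQ_pos hQ
  have hfr : (0 : ℝ) < farCoeffQ c := by exact_mod_cast hf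
  have hDr : (0 : ℝ) < D := by exact_mod_cast hD
  rw [farCoeff_eq_cast (ne_of_gt hQ), midP]
  field_simp

/-- far classes have `Q > 0` (indeed `Q > qn ≥ 0`). [folklore] -/
theorem qint_pos_of_mem_classRange {qn qf : ℤ} (hqn : 0 ≤ qn) {c : BondClass} (hc : c ∈ classRange qn qf) :
    0 < Qint c := by
  have := (qint_of_mem_classRange hc).1; omega

/-- **`MidBound` for the rounded path constants.** [folklore] -/
theorem midBound_midP (hC : ChainBound) (hP : PathBound) {Rf Rinf : ℝ} (hRf : 0 ≤ Rf) {D : ℕ} (hD : 0 < D) :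
    MidBound Rf Rinf (midP D) := by
  intro c hc
  have hcn : c ∉ classesR Rf := (mem_farClasses.mp hc).2
  have hnd : ¬ diagClass c := not_diagClass_of_notMem hRf hcn
  have hQ : 0 < Qint c := by
    have h1 : 1 ≤ ‖bondVec 0 c‖ := PullbackStub.one_le_norm_bondVec_zero hnd
    have h := qint_cast c
    have : (0 : ℝ) < (Qint c : ℝ) := by rw [h]; nlinarith
    exact_mod_cast this
  refine ⟨midP_nonneg hD hQ, fun w hw => ?_⟩
  have h1 := hP hC c hnd w hw
  have hN : 0 ≤ N0 w := Finset.sum_nonneg fun c' _ => tsum_nonneg fun _ => by positivity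
  exact h1.trans (mul_le_mul_of_nonneg_right (pathConst_le_midP hD hQ) hN)

/-- **the mid-range constant as a range sum:** `Σ_{(Rf,R∞]} farCoeff · midP D = (sumRange (midCeil D) qf q∞) / D`. -/
theorem sum_farCoeff_midP_eq {Rf Rinf : ℝ} {bf bi : ℕ} {qf qi : ℤ} (hbf : ⌈2 * Rf⌉₊ + 1 = bf)
    (hqf : ((qf : ℤ) : ℝ) = 36 * Rf ^ 2) (hbi : ⌈2 * Rinf⌉₊ + 1 = bi) (hqi : ((qi : ℤ) : ℝ) = 36 * Rinf ^ 2)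
    (hRf : 0 ≤ Rf) (hRinf : 0 ≤ Rinf) {D : ℕ} (hD : 0 < D) :
    ∑ c ∈ farClasses Rf Rinf, farCoeff c * midP D c = ((sumRange (fun c => (midCeil D c : ℚ)) qf qi : ℚ) : ℝ) / D := by
  have hqf0 : 0 ≤ qf := by
    have : (0 : ℝ) ≤ (qf : ℝ) := by rw [hqf]; positivity
    exact_mod_cast this
  rw [sum_farClasses_eq hbf hqf hbi hqi hRf hRinf, sumRange_eq]
  have key : ∀ c ∈ classRange qf qi, farCoeff c * midP D c = (midCeil D c : ℝ) / D := fun c hc =>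
    farCoeff_mul_midP hD (qint_pos_of_mem_classRange hqf0 hc)
  have hdiv : ∀ l : List BondClass,
      (l.map fun a => (midCeil D a : ℝ) / D).sum = (l.map fun a => (midCeil D a : ℝ)).sum / D := by
    intro l
    induction l with
    | nil => simp
    | cons a rest ih => simp [ih]; ring
  rw [List.map_congr_left key, hdiv]
  congr 1
  rw [Rat.cast_list_sum, List.map_map]
  congr 1

/-! ## The `N0`-charge -/

/-- `−K · N0` as a polynomial pair form (constant monomial) -/
def farN0PPF (K : ℚ) : PolyPF := nnList.flatMap fun c => classPPF c [([], fun i j => -K * M0inv i j)]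

/-- **`evalPPF (farN0PPF K) = −K · N0 w`.** [folklore] -/
theorem evalPPF_farN0PPF (K : ℚ) (x : ℕ → ℝ) {w : Label → E3} (hw : (support w).Finite) :
    evalPPF (farN0PPF K) x w = -(K : ℝ) * N0 w := by
  unfold farN0PPF N0
  rw [evalPPF_flatMap, sum_nnClasses_eq, ← List.sum_map_mul_left]
  congr 1
  refine List.map_congr_left fun c _ => ?_
  rw [evalPPF_classPPF hw, plainForm_eq_pairEvalR, ← pairEvalR_smul]
  congr 1
  funext i j
  simp [matVal, monoVal]

/-- Anchor of this support file (registered stub of the line skeleton, lead c2). -/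
theorem stub_certCharge : ∀ (c : BondClass), Qint c ≠ 0 → farCoeff c = ((18 * (36 / (Qint c : ℚ)) ^ 4 : ℚ) : ℝ) :=
  fun _ hc => farCoeff_eq_cast hc

end Summit.AtomisticToContinuum.Crystallization.Theorems.PhononStabilityCWC.Cert

end
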